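import Literature.AlgebraicGeometry.ComplexMultiplication.FieldOfDegreeTwoDimSemisimpleSplitting
import Literature.AlgebraicGeometry.Motives.AbelianVarietyPoincarePerfectField
import Literature.AlgebraicGeometry.Motives.AbelianVarietySimpleOfIsogenyAnyField
import Literature.AlgebraicGeometry.Motives.AbelianVarietySimpleOfIsogeny
import Literature.AlgebraicGeometry.Motives.AbelianVarietyBiproductSubvarieties
import HarnessLib

/-!
# An abelian subvariety is, up to isogeny, the image of a quasi-idempotent endomorphism of the ambient variety;
# the simple factor of a CM cut as such an image

D. Mumford, *Abelian Varieties* (1970), §19, proof of Thm. 1 / Cor. 2 (pp. 173–174): for an abelian subvariety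
`i : Y ↪ X` Poincaré's theorem supplies `h : X → Y` with `h ∘ i = N` («quasi-retraction»); H. Lange, Ch. Birkenhake
/ H. Lange, *Abelian Varieties over the Complex Numbers* (2023) §2.4.3 (`X^ε = Im(nε)` for a symmetric idempotent `ε`,
«this definition does not depend on the choice of `n`»): abelian subvarieties are images of (quasi-)idempotents of
`End(X)`.  [Liu2021] App. D §D.4 l. 5626: «Using Hecke operators, we may find a surjective homomorphism `φ : A_K → B`
… Let `B_0` be some simple factor of `B`» — the simple factor realised from the ambient Jacobian.

THIS FILE (theorems only, over a PERFECT field for §1–2 and over a subfield `k ⊆ ℂ` for §3):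
* §1 `exists_quasiIdempotent_isIsogenous_image_of_isClosedImmersion` — for a closed abelian subvariety `i : Y ↪ X`
  there is `u : X ⟶ X` with `u ≫ u = N • u`, `N ≠ 0`, and `Im u ∼ Y` (both directions): `u := h ≫ i` for the Poincaré
  quasi-retraction `h` (★ `exists_quasiRetraction_of_perfectField`), the isogenies `Y → Im u`, `Im u → Y` being
  `i ≫ toImage u` and `imageι u ≫ h` with both composites `= N²` (★ `imageι_comp_self_eq_nsmul_imageι`,
  ★ `imageι_comp_toImage_eq_nsmul_id`, ★ `isIsogeny_of_comp_eq_nsmul_id_of_dim_eq`);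
* §2 `exists_quasiIdempotent_isIsogenous_image_of_isSimple` — a SIMPLE `B` with a non-zero `f : B ⟶ X` is isogenous to
  `Im u` for a quasi-idempotent `u` of `X` (`Y := Im f`, ★ `IsSimple.isIsogenous_image_of_ne_zero`);
* §3 **`exists_quasiIdempotent_image_isSimple_numberField_of_comm_isReduced`** — the geometric half of the d6 stub S2′:
  for a quasi-idempotent `u₀` of `A` over `k ⊆ ℂ` and a commutative reduced `R ⊆ End⁰_k(Im u₀)` of degree
  `2 dim (Im u₀) > 0`, there is a quasi-idempotent `u` of `A` ITSELF with `Im u` SIMPLE over `k`, `0 < dim (Im u)`, and a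
  number field `M` with a BIJECTIVE `M →+* End⁰_k(Im u)`, `[M : ℚ] = 2 dim (Im u)` (★
  `exists_orthogonal_quasiIdempotents_isSimple_factor_of_comm_isReduced` + §2 through `Im u_i ↪ Im u₀ ↪ A` + isogeny
  invariance ★ `IsIsogenous.isField_endAlgebra_iff` / `finrank_endAlgebra_eq` / `IsSimple.of_isIsogenous`).

What is NOT here: CM-ness of `M` (G-ros), and any statement about eigen classes.  No definition, no named fact, no
instance, no `sorry`.

DICTIONARY LINE (cell `hodgecm-mathlib`, crux `HLiu418` = stmt-HodgeConjecture-24832, d6 card S2′ / glue probe v5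
`S2primeShape`): `A := C.A K` (Albanese at level `K`), `u₀ :=` the integral Hecke quasi-idempotent of the `ω⋆_lab`-isotypic
part, `R :=` the multiplicity-one commutative algebra on `Im u₀`; §3 delivers `S2primeShape`'s `(u, a, M, i, hdim)` with
`Im u` k-simple — leaving `[IsCMField M]` (G-ros) and the eigen class (S1).  The file moves no book (HC_CM is proved only
modulo the 7 printed citations until rung 0 closes).

## References
* [MumfordAV1970] D. Mumford, *Abelian Varieties* (1970), §19 Thm. 1 and proof of Cor. 2 (pp. 173–174).
* [Milne1986AbelianVarieties] J. S. Milne, *Abelian Varieties*, in Cornell–Silverman (1986), §12 Prop. 12.1 (p. 122).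
* [Liu2021] Y. Liu, *Fourier–Jacobi cycles and arithmetic relative trace formula*, Camb. J. Math. 9 (2021), App. D §D.4
  (FJcycle.tex l. 5626–5627).
* [Shimura1998] G. Shimura, *Abelian Varieties with Complex Multiplication and Modular Functions* (1998), §5.1
  Propositions 3 and 4 (p. 37), Proposition 6 (p. 39).
-/

noncomputable section

open CategoryTheory CategoryTheory.Limits AlgebraicGeometry

namespace Literature.AlgebraicGeometry.Motives

namespace AbelianVariety

universe u

/-! ### §1 A closed abelian subvariety is isogenous to the image of a quasi-idempotent -/

section Perfect

variable {K : Type u} [Field K] [PerfectField K] {X Y : AbelianVariety K}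

/-- **A closed abelian subvariety `i : Y ↪ X` (perfect ground field) is isogenous — in both directions — to the image of a
quasi-idempotent endomorphism `u` of `X`** (`u = h ≫ i`, `h` a Poincaré quasi-retraction, `u ≫ u = N • u`).
[cite: MumfordAV1970, §19 Thm. 1 and proof of Cor. 2 (pp. 173–174)] [cite: Milne1986AbelianVarieties, §12 Prop. 12.1 (p. 122)] -/
theorem exists_quasiIdempotent_isIsogenous_image_of_isClosedImmersion (i : Y ⟶ X)
    [IsClosedImmersion (Hom.toSchemeHom i)] :
    ∃ (u : X ⟶ X) (N : ℕ), N ≠ 0 ∧ u ≫ u = N • u ∧ Y.IsIsogenous (image u) ∧ (image u).IsIsogenous Y := by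
  obtain ⟨h, N, hN, hih⟩ := exists_quasiRetraction_of_perfectField i
  let u : X ⟶ X := h ≫ i
  have huu : u ≫ u = N • u := by
    change (h ≫ i) ≫ (h ≫ i) = N • (h ≫ i)
    rw [Category.assoc, ← Category.assoc i h i, hih, Preadditive.nsmul_comp, Category.id_comp, Preadditive.comp_nsmul]
  -- `Y → Im u → Y` is `N²`
  have h1 : (i ≫ toImage u) ≫ (imageι u ≫ h) = (N * N) • 𝟙 Y := by
    rw [Category.assoc, ← Category.assoc (toImage u), toImage_imageι]
    change i ≫ (h ≫ i) ≫ h = (N * N) • 𝟙 Y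
    rw [Category.assoc, ← Category.assoc i h (i ≫ h), hih, Preadditive.nsmul_comp, Category.id_comp, ← mul_nsmul]
  -- `Im u → Y → Im u` is `N²`
  have h2 : (imageι u ≫ h) ≫ (i ≫ toImage u) = (N * N) • 𝟙 (image u) := by
    rw [Category.assoc, ← Category.assoc h i, show h ≫ i = u from rfl, ← Category.assoc,
      imageι_comp_self_eq_nsmul_imageι huu, Preadditive.nsmul_comp, imageι_comp_toImage_eq_nsmul_id huu, ← mul_nsmul]
  have hNN : N * N ≠ 0 := mul_ne_zero hN hN
  -- dimensions agree (each composite is an isogeny-multiple of the identity)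
  have hle1 : Y.dim ≤ (image u).dim := dim_le_of_comp_eq_nsmul_id hNN h1
  have hle2 : (image u).dim ≤ Y.dim := dim_le_of_comp_eq_nsmul_id hNN h2
  have hdim : Y.dim = (image u).dim := le_antisymm hle1 hle2
  exact ⟨u, N, hN, huu, ⟨i ≫ toImage u, (isIsogeny_of_comp_eq_nsmul_id_of_dim_eq hNN h1 hdim).1⟩,
    ⟨imageι u ≫ h, (isIsogeny_of_comp_eq_nsmul_id_of_dim_eq hNN h2 hdim.symm).1⟩⟩

/-! ### §2 A simple isogeny factor as the image of a quasi-idempotent -/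

/-- **A SIMPLE `B` mapping non-trivially to `X` is isogenous to the image of a quasi-idempotent of `X`**: `B ∼ Im f`
(★ `IsSimple.isIsogenous_image_of_ne_zero`) and `Im f ↪ X` is a closed abelian subvariety (§1).
[cite: MumfordAV1970, §19 Thm. 1 and proof of Cor. 2 (pp. 173–174)] -/
theorem exists_quasiIdempotent_isIsogenous_image_of_isSimple {B : AbelianVariety K} (hB : B.IsSimple) {f : B ⟶ X}
    (hf : f ≠ 0) :
    ∃ (u : X ⟶ X) (N : ℕ), N ≠ 0 ∧ u ≫ u = N • u ∧ B.IsIsogenous (image u) ∧ (image u).IsIsogenous B := by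
  haveI := isClosedImmersion_toSchemeHom_imageι f
  obtain ⟨u, N, hN, huu, h1, h2⟩ := exists_quasiIdempotent_isIsogenous_image_of_isClosedImmersion (imageι f)
  have hBf : B.IsIsogenous (image f) := hB.isIsogenous_image_of_ne_zero hf
  -- `Im f → B`: quasi-inverse of the isogeny `B → Im f`
  obtain ⟨g, hg⟩ := hBf
  obtain ⟨g', n, hn, -, hg'g⟩ := IsIsogeny.exists_nsmul_inverse_holds hg
  have hfB : (image f).IsIsogenous B :=
    ⟨g', (isIsogeny_of_comp_eq_nsmul_id_of_dim_eq hn.ne' hg'g (dim_eq_of_isIsogeny hg).symm).1⟩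
  exact ⟨u, N, hN, huu, (show B.IsIsogenous (image f) from ⟨g, hg⟩).trans h1, h2.trans hfB⟩

end Perfect

/-! ### §3 The geometric half of S2′: a simple CM factor as the image of a quasi-idempotent of the ambient variety -/

section Subfield

variable {k : Type} [Field k] [Algebra k ℂ] {A : AbelianVariety k}

/-- **From a commutative semisimple algebra of full degree on `Im u₀` to a SIMPLE `Im u` with an endomorphism number
field of full degree, `u` a quasi-idempotent of the AMBIENT `A`.**  For `A` over `k ⊆ ℂ`, a quasi-idempotent `u₀`
(`u₀ ≫ u₀ = a • u₀`, only its image is used) and a commutative reduced `ℚ`-subalgebra `R ⊆ End⁰_k(Im u₀)` with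
`dim_ℚ R = 2 dim (Im u₀) > 0`: there are `u : A ⟶ A`, `N ≠ 0` with `u ≫ u = N • u`, `Im u` SIMPLE over `k` of positive
dimension, and a number field `M` with a bijective `j : M →+* End⁰_k(Im u)`, `[M : ℚ] = 2 dim (Im u)`.
[cite: Liu2021, App. D §D.4 (FJcycle.tex l. 5626–5627)] [cite: Shimura1998, §5.1 Propositions 3 and 4 (p. 37), Proposition 6 (p. 39)]
[cite: MumfordAV1970, §19 Thm. 1 and proof of Cor. 2 (pp. 173–174)] -/
theorem exists_quasiIdempotent_image_isSimple_numberField_of_comm_isReduced (u₀ : A ⟶ A)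
    (R : Subalgebra ℚ (image u₀).endAlgebra) (hcomm : ∀ x ∈ R, ∀ y ∈ R, x * y = y * x) [IsReduced R]
    (hdeg : Module.finrank ℚ R = 2 * (image u₀).dim) (hpos : 0 < (image u₀).dim) :
    ∃ (u : A ⟶ A) (N : ℕ), N ≠ 0 ∧ u ≫ u = N • u ∧ (image u).IsSimple ∧ 0 < (image u).dim ∧
      ∃ (M : Type) (_ : Field M) (_ : NumberField M) (j : M →+* (image u).endAlgebra),
        Function.Bijective j ∧ Module.finrank ℚ M = 2 * (image u).dim := by
  classical
  haveI : CharZero k := (algebraMap k ℂ).charZero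
  -- split `Im u₀` by `R` and take the simple piece of one factor
  obtain ⟨ι, _, N₁, v, hN₁, -, hsum, -, hfac⟩ :=
    Literature.AlgebraicGeometry.ComplexMultiplication.exists_orthogonal_quasiIdempotents_isSimple_factor_of_comm_isReduced
      R hcomm hdeg
  -- there is at least one factor (the sum of the `v_i` is `N₁ ≠ 0` on a variety of positive dimension)
  have hne : Nonempty ι := by
    by_contra hι
    haveI : IsEmpty ι := not_nonempty_iff.1 hι
    have h0 : (N₁ • 𝟙 (image u₀) : image u₀ ⟶ image u₀) = 0 := by
      rw [← hsum, Finset.univ_eq_empty, Finset.sum_empty]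
    exact id_ne_zero_of_dim_pos hpos (hom_eq_zero_of_nsmul_eq_zero hN₁ h0)
  obtain ⟨i₀⟩ := hne
  obtain ⟨B, n, hn, hB, hiso, M, _, _, j, hj, hMdeg⟩ := hfac i₀
  -- a non-zero map `B → Im (v i₀)`: the first inclusion followed by a quasi-inverse of `Im (v i₀) → ⨁ B`
  obtain ⟨g, hg⟩ := hiso
  obtain ⟨g', m, hm, hgg', hg'g⟩ := IsIsogeny.exists_nsmul_inverse_holds hg
  have hBpos : 0 < B.dim := by
    have := Module.finrank_pos (R := ℚ) (M := M)
    omega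
  let f : B ⟶ image (v i₀) := biproduct.ι (fun _ : Fin n => B) ⟨0, hn⟩ ≫ g'
  have hf : f ≠ 0 := by
    intro hf0
    have h1 : f ≫ g ≫ biproduct.π (fun _ : Fin n => B) ⟨0, hn⟩ = m • 𝟙 B := by
      change (biproduct.ι _ _ ≫ g') ≫ g ≫ biproduct.π _ _ = _
      rw [Category.assoc, ← Category.assoc g' g, hg'g, Preadditive.nsmul_comp, Category.id_comp,
        Preadditive.comp_nsmul, biproduct.ι_π_self]
    rw [hf0, zero_comp] at h1
    exact id_ne_zero_of_dim_pos hBpos (hom_eq_zero_of_nsmul_eq_zero hm.ne' h1.symm)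
  -- `B → Im (v i₀) ↪ Im u₀ ↪ A`, still non-zero (closed immersions are monomorphisms)
  let F : B ⟶ A := f ≫ imageι (v i₀) ≫ imageι u₀
  have hF : F ≠ 0 := by
    intro hF0
    haveI := isClosedImmersion_toSchemeHom_imageι (v i₀)
    haveI := isClosedImmersion_toSchemeHom_imageι u₀
    haveI : Mono (imageι (v i₀) ≫ imageι u₀) := mono_comp _ _
    exact hf ((cancel_mono (imageι (v i₀) ≫ imageι u₀)).1 (by rw [zero_comp]; exact hF0))
  obtain ⟨u, N, hN, huu, hBu, huB⟩ := exists_quasiIdempotent_isIsogenous_image_of_isSimple hB hF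
  refine ⟨u, N, hN, huu, IsSimple.of_isIsogenous hBu hB, ?_, ?_⟩
  · rw [← hBu.dim_eq]; exact hBpos
  -- transport the number field along `End⁰(B) ≃ End⁰(Im u)`
  obtain ⟨e⟩ := hBu.nonempty_endAlgebra_algEquiv
  refine ⟨M, inferInstance, inferInstance, e.toRingEquiv.toRingHom.comp j, ?_, by rw [hMdeg, hBu.dim_eq]⟩
  exact e.bijective.comp hj

end Subfield

end AbelianVariety

end Literature.AlgebraicGeometry.Motives

end
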